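import Literature.AnabelianGeometry.SemiGraphs.ProSigmaPuncturedSlim
import Literature.GroupTheory.CombinatorialGroupTheory.OneRelatorModPrimeHomologyFaithful
import HarnessLib

/-!
# Slimness of pro-`Σ` completions of closed surface groups ([AbsAnab] Lemma 1.3.1, proper case)

[AbsAnab] (Mochizuki, *The absolute anabelian geometry of hyperbolic curves*, 2004) Lemma 1.3.1
p. 15: the geometric pro-`Σ` fundamental group of a hyperbolic curve is SLIM; [SemiAnbd] Example
2.10 p. 31 uses it as "verticially slim".  abc-iut-L5-t9's `ProSigmaPuncturedSlim.lean` proved the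
AFFINE case (`r ≥ 1`: free groups) and reduced abc-iut-L3-t11's named fact
`Literature.AnabelianGeometry.SemiGraphs.ProSigmaSurfaceGroupSlim` to its CLOSED-SURFACE case
`h0` (`r = 0`, `g ≥ 2`).  This file discharges `h0` UNCONDITIONALLY — in particular without the
finite-index-subgroup structure of surface groups (no Riemann–Hurwitz / `SurfaceGroupFiniteIndexSubgroup`):

* `isSlimGroup_of_oneRelator` — for ANY one-relator group `Γ = ⟨α ∣ r⟩` on `|α| ≥ 4` generators,
  every pro-`Σ` completion `ι : Γ → P` (`Σ` a nonempty set of primes, `P` profinite) is slim.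
  Proof: for `z` centralising an open `H`, take an open normal `N ⊆ H` with `z ∉ N`,
  `Γ₁ = ι⁻¹N`, and `γ ∈ Γ` with `ι γ ∈ z N`; the elementary abelian quotient
  `Γ₁ → Γ₁/⁅Γ₁,Γ₁⁆Γ₁^ℓ` (`ℓ ∈ Σ`) is a finite `ℓ`-group, so it extends to `N`
  (`exists_continuous_extend`); as `z` centralises `N`, conjugation by `γ` is trivial on it, and the
  group-theoretic theorem `PresentedGroup.mem_of_conj_mul_inv_mem_commutatorPow`
  (`OneRelatorModPrimeHomologyFaithful.lean`: one-relator groups on `≥ 4` generators act faithfully on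
  the mod-`ℓ` homology of their finite-index normal subgroups) gives `γ ∈ Γ₁`, i.e. `z ∈ N` — absurd.
* `isSlimGroup_closedSurfaceGroup` — the hypothesis `h0` of `proSigmaSurfaceGroupSlim_of_closed`
  verbatim (`Γ_{g,0}` is one-relator on `2g ≥ 4` generators);
* `proSigmaSurfaceGroupSlim_holds : ProSigmaSurfaceGroupSlim` — abc-iut-L3-t11's named fact
  ([AbsAnab] Lemma 1.3.1 in pro-`Σ` form, all hyperbolic `(g, r)`), now a theorem;
* `SemiGraphOfAnabelioids.isVerticiallySlim_of_isOfSurfaceType'` — [SemiAnbd] Example 2.10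
  conjunct (5): every semi-graph of anabelioids of surface type is verticially slim, unconditionally.

Theorems only; no side is taken on [IUTchIII] Cor. 3.12.
-/

universe u v v₁ u₁

namespace Literature.AnabelianGeometry.SemiGraphs.SemiGraphOfAnabelioids.IsProSigmaCompletion

open Literature.AnabelianGeometry.Anabelioids Literature.AlgebraicGeometry.Frobenioids
open Literature.GroupTheory.CombinatorialGroupTheory
open scoped IsMulCommutative

variable {Sigma : Set ℕ}

/-- **Pro-`Σ` completions of one-relator groups on `≥ 4` generators are slim.**  `Γ = ⟨α ∣ r⟩` with
`α` finite, `|α| ≥ 4`, `r` arbitrary; `Σ` a nonempty set of primes; `ι : Γ → P` a pro-`Σ` completion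
(`P` compact Hausdorff totally disconnected).  Then the centraliser of every open subgroup of `P`
is trivial. [cite: MochizukiAbsAnab2004, Lemma 1.3.1 p.15] -/
theorem isSlimGroup_of_oneRelator {α : Type u} [Finite α] (hα : 4 ≤ Nat.card α) (r : FreeGroup α)
    (hS : Sigma.Nonempty) (hSp : ∀ p ∈ Sigma, p.Prime)
    {P : Type v} [Group P] [TopologicalSpace P] [IsTopologicalGroup P] [CompactSpace P]
    [T2Space P] [TotallyDisconnectedSpace P]
    (ι : PresentedGroup ({r} : Set (FreeGroup α)) →* P) (hι : IsProSigmaCompletion Sigma ι) :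
    IsSlimGroup P := by
  classical
  obtain ⟨ℓ, hℓS⟩ := hS
  have hℓ : ℓ.Prime := hSp ℓ hℓS
  refine ⟨fun H hH => ?_⟩
  rw [eq_bot_iff]
  intro z hz
  rw [Subgroup.mem_bot]
  by_contra hz1
  -- an open normal subgroup `N ⊆ H` missing `z`
  obtain ⟨N₀, hN₀⟩ := ProfiniteGrp.exist_openNormalSubgroup_sub_open_nhds_of_one
    (isOpen_compl_singleton (x := z)) (show (1 : P) ∈ ({z}ᶜ : Set P) from fun h => hz1 h.symm)
  obtain ⟨N₁, hN₁H⟩ := exists_openNormal_le H hH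
  haveI := N₀.isNormal'
  haveI := N₁.isNormal'
  let N : Subgroup P := (N₀ : Subgroup P) ⊓ (N₁ : Subgroup P)
  haveI hNn : N.Normal := inferInstance
  have hNo : IsOpen (N : Set P) := N₀.isOpen'.inter N₁.isOpen'
  have hzN : z ∉ N := fun h => hN₀ h.1 rfl
  have hNH : N ≤ H := inf_le_right.trans hN₁H
  have hzc : ∀ n ∈ N, n * z = z * n := fun n hn => Subgroup.mem_centralizer_iff.mp hz n (hNH hn)
  -- `Γ₁ = ι⁻¹ N`, a normal subgroup of finite index
  set Γ₁ : Subgroup (PresentedGroup ({r} : Set (FreeGroup α))) := N.comap ι with hΓ₁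
  haveI : Γ₁.Normal := hNn.comap ι
  haveI : Γ₁.FiniteIndex := finiteIndex_comap hι N hNo
  -- `γ` with `ι γ ∈ z N`
  obtain ⟨γ, hγ⟩ := exists_mem_coset hι N hNo z
  -- the mod-`ℓ` abelianization `Q = Γ₁ / ⁅Γ₁,Γ₁⁆Γ₁^ℓ`
  set M : Subgroup (PresentedGroup ({r} : Set (FreeGroup α))) :=
    ⁅Γ₁, Γ₁⁆ ⊔ Subgroup.normalClosure ((fun y => y ^ ℓ) ''
      (Γ₁ : Set (PresentedGroup ({r} : Set (FreeGroup α))))) with hM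
  let M₁ : Subgroup Γ₁ := M.subgroupOf Γ₁
  haveI : M₁.Normal := inferInstance
  haveI hQc : IsMulCommutative (Γ₁ ⧸ M₁) := by
    refine isMulCommutative_iff.mpr fun a b => ?_
    obtain ⟨x, rfl⟩ := QuotientGroup.mk_surjective a
    obtain ⟨y, rfl⟩ := QuotientGroup.mk_surjective b
    rw [← QuotientGroup.mk_mul, ← QuotientGroup.mk_mul, QuotientGroup.eq, Subgroup.mem_subgroupOf]
    have h : ((x * y)⁻¹ * (y * x) : Γ₁) = (x * y)⁻¹ * (x * y * x⁻¹ * y⁻¹)⁻¹ * (x * y) := by group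
    rw [h]
    refine (hNn.comap ι |> fun _ => ?_)
    have hc : ((x * y * x⁻¹ * y⁻¹ : Γ₁) : PresentedGroup ({r} : Set (FreeGroup α))) ∈ M :=
      Subgroup.mem_sup_left (by
        simpa [commutatorElement_def] using Subgroup.commutator_mem_commutator x.2 y.2)
    have hMn : M.Normal := inferInstance
    simpa only [Subgroup.coe_mul, Subgroup.coe_inv] using
      hMn.conj_mem' _ (M.inv_mem hc) ((x * y : Γ₁) : PresentedGroup ({r} : Set (FreeGroup α)))
  have hQpow : ∀ q : Γ₁ ⧸ M₁, q ^ ℓ = 1 := by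
    intro q
    obtain ⟨x, rfl⟩ := QuotientGroup.mk_surjective q
    rw [← QuotientGroup.mk_pow, QuotientGroup.eq_one_iff, Subgroup.mem_subgroupOf, Subgroup.coe_pow]
    exact Subgroup.mem_sup_right (Subgroup.subset_normalClosure ⟨x, x.2, rfl⟩)
  haveI : Group.FG (PresentedGroup ({r} : Set (FreeGroup α))) :=
    Group.fg_of_surjective (PresentedGroup.mk_surjective _)
  haveI : Group.FG (Γ₁ ⧸ M₁) := Group.fg_of_surjective (QuotientGroup.mk'_surjective M₁)
  have hQcard : Nat.card (Γ₁ ⧸ M₁) ≠ 0 :=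
    (natCard_le_pow_of_forall_pow_eq_one hℓ.ne_zero hQpow le_rfl).1
  haveI : Finite (Γ₁ ⧸ M₁) := Nat.finite_of_card_ne_zero hQcard
  have hQsigma : IsSigmaInteger Sigma (Nat.card (Γ₁ ⧸ M₁)) := by
    refine ⟨Nat.pos_of_ne_zero hQcard, fun p hp hpd => ?_⟩
    have hdvd := card_dvd_exponent_pow_rank' (Γ₁ ⧸ M₁) hQpow
    have : p ∣ ℓ := hp.dvd_of_dvd_pow (hpd.trans hdvd)
    rwa [(Nat.prime_dvd_prime_iff_eq hp hℓ).mp this]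
  letI : TopologicalSpace (Γ₁ ⧸ M₁) := ⊥
  haveI : DiscreteTopology (Γ₁ ⧸ M₁) := ⟨rfl⟩
  -- extend the quotient map `Γ₁ → Q` to `N`
  obtain ⟨F, -, hF⟩ := exists_continuous_extend hι N hNo hQsigma (QuotientGroup.mk' M₁)
  -- conjugation by `γ` is trivial on `Q`: `z` centralises `N ∋ n₀ = z⁻¹ ι γ`
  have hkey : ∀ x ∈ Γ₁, γ * x * γ⁻¹ * x⁻¹ ∈ M := by
    intro x hx
    have hcx : γ * x * γ⁻¹ ∈ Γ₁ := ‹Γ₁.Normal›.conj_mem x hx γ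
    have hm : γ * x * γ⁻¹ * x⁻¹ ∈ Γ₁ := Γ₁.mul_mem hcx (Γ₁.inv_mem hx)
    suffices h : (QuotientGroup.mk' M₁ ⟨_, hm⟩ : Γ₁ ⧸ M₁) = 1 by
      rw [QuotientGroup.mk'_apply, QuotientGroup.eq_one_iff, Subgroup.mem_subgroupOf] at h
      exact h
    have e1 : (⟨_, hm⟩ : Γ₁) = ⟨γ * x * γ⁻¹, hcx⟩ * ⟨x, hx⟩⁻¹ := Subtype.ext rfl
    rw [e1, map_mul, map_inv, ← hF _ hcx, ← hF _ hx]
    have hcxN : ι (γ * x * γ⁻¹) ∈ N := hcx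
    have e2 : (⟨ι (γ * x * γ⁻¹), hcx⟩ : N) =
        ⟨z⁻¹ * ι γ, hγ⟩ * ⟨ι x, hx⟩ * ⟨z⁻¹ * ι γ, hγ⟩⁻¹ := by
      apply Subtype.ext
      change ι (γ * x * γ⁻¹) = (z⁻¹ * ι γ) * ι x * (z⁻¹ * ι γ)⁻¹
      have hz' := hzc _ hcxN
      rw [map_mul, map_mul, map_inv] at hz' ⊢
      calc ι γ * ι x * (ι γ)⁻¹ = z⁻¹ * (z * (ι γ * ι x * (ι γ)⁻¹)) := by group
        _ = z⁻¹ * ((ι γ * ι x * (ι γ)⁻¹) * z) := by rw [hz']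
        _ = (z⁻¹ * ι γ) * ι x * (z⁻¹ * ι γ)⁻¹ := by group
    rw [e2, map_mul, map_mul, map_inv, mul_inv_cancel_comm, mul_inv_cancel]
  -- the group-theoretic theorem: `γ ∈ Γ₁`, i.e. `ι γ ∈ N`, whence `z ∈ N`
  have hmem : γ ∈ Γ₁ :=
    PresentedGroup.mem_of_conj_mul_inv_mem_commutatorPow hα r Γ₁ hℓ γ hkey
  have hιγ : ι γ ∈ N := hmem
  apply hzN
  have := N.mul_mem hιγ (N.inv_mem hγ)
  rwa [mul_inv_rev, inv_inv, mul_inv_cancel_left] at this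

/-- **The closed-surface case `h0` of `ProSigmaSurfaceGroupSlim`, unconditionally**: for `Σ` a nonempty
set of primes and `g ≥ 2`, every pro-`Σ` completion of the closed surface group `Γ_{g,0}` is slim —
exactly the hypothesis `h0` of abc-iut-L5-t9's `proSigmaSurfaceGroupSlim_of_closed` /
`example_2_10_verticiallySlim_of_closed` (`Γ_{g,0}` is one-relator on `2g ≥ 4` generators).
[cite: MochizukiAbsAnab2004, Lemma 1.3.1 p.15] -/
theorem isSlimGroup_closedSurfaceGroup (Sigma : Set ℕ) (hS : Sigma.Nonempty)
    (hSp : ∀ p ∈ Sigma, p.Prime) (g : ℕ) (hg : 2 ≤ g)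
    (P : Type v) [Group P] [TopologicalSpace P] [IsTopologicalGroup P] [CompactSpace P]
    [T2Space P] [TotallyDisconnectedSpace P] (ι : PuncturedSurfaceGroup g 0 →* P)
    (hι : IsProSigmaCompletion Sigma ι) : IsSlimGroup P := by
  refine isSlimGroup_of_oneRelator (α := puncturedSurfaceGen g 0) ?_
    (PuncturedSurfaceGroup.relator g 0) hS hSp ι hι
  simp only [puncturedSurfaceGen, Nat.card_eq_fintype_card, Fintype.card_sum, Fintype.card_prod,
    Fintype.card_fin, Fintype.card_bool]
  omega

end SemiGraphOfAnabelioids.IsProSigmaCompletion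

open Literature.AlgebraicGeometry.Frobenioids Literature.GroupTheory.CombinatorialGroupTheory

/-- **[AbsAnab] Lemma 1.3.1 in pro-`Σ` form (abc-iut-L3-t11's named fact `ProSigmaSurfaceGroupSlim`)
HOLDS**: for every nonempty set of primes `Σ` and every hyperbolic type `(g, r)`, every pro-`Σ`
completion of the punctured surface group `Γ_{g,r}` is slim — the punctured case by abc-iut-L5-t9's
`proSigmaSurfaceGroupSlim_of_closed`, the closed case by `isSlimGroup_closedSurfaceGroup`.
[cite: MochizukiAbsAnab2004, Lemma 1.3.1 p.15] -/
theorem proSigmaSurfaceGroupSlim_holds : ProSigmaSurfaceGroupSlim.{v} :=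
  SemiGraphOfAnabelioids.proSigmaSurfaceGroupSlim_of_closed
    SemiGraphOfAnabelioids.IsProSigmaCompletion.isSlimGroup_closedSurfaceGroup

/-- **[SemiAnbd] Example 2.10, conjunct (5), unconditionally**: every semi-graph of anabelioids of
surface type is verticially slim (abc-iut-L3-t11's `example_2_10_verticiallySlim_of` fed with
`proSigmaSurfaceGroupSlim_holds`). [cite: MochizukiSemiAnbd2006, Ex. 2.10 p.31] -/
theorem SemiGraphOfAnabelioids.isVerticiallySlim_of_isOfSurfaceType'
    (𝒢 : SemiGraphOfAnabelioids.{v₁, u₁, u}) (Sigma : Set ℕ) (hS : 𝒢.IsOfSurfaceType Sigma) :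
    𝒢.IsVerticiallySlim :=
  SemiGraphOfAnabelioids.example_2_10_verticiallySlim_of proSigmaSurfaceGroupSlim_holds 𝒢 Sigma hS

end Literature.AnabelianGeometry.SemiGraphs
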